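import Literature.AnabelianGeometry.AbsoluteAnabelian.AbsTopI.CofreeCore
import HarnessLib

/-!
# [AbsTopI] §0 p. 8: co-free subgroups and the co-free core PULL BACK along continuous homomorphisms
# (proof-only companion of `AbsTopI/CofreeCore.lean`)

S. Mochizuki, *Topics in Absolute Anabelian Geometry I: Generalities* [AbsTopI] (J. Math. Sci. Univ.
Tokyo 19 (2012)), §0 "Topological Groups", manuscript p. 8 (lit key `paper:url-11ac98ba15fc`, read on
the page): "a normal open subgroup `H ⊆ G` such that the quotient group `G/H` is a free discrete group
[is] co-free [...] minimal if every co-free subgroup of `G` contains `H`", and Prop 4.10 (iii) p. 60 /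
proof p. 61 ("Assertion (iii) follows immediately from assertion (i)").

The one group-theoretic fact behind the INCLUSION half of the comparison of minimal co-free subgroups
along a homomorphism (row iii.L04 of the cell's sub-DAG `HOME/plan/L4/SUBDAG-AbsTopI-Prop410.md`; the
hypothesis `hcompat` of `coFreeCofinalImAlong_right_of`, `AbsTopIProp410CofinalProofs.lean`):

* `IsCofreeIn.comap_inf` — if `K` is co-free in `H ≤ Π₂` and `f : Π₁ → Π₂` is a continuous
  homomorphism with `f(U) ⊆ H`, then `f⁻¹(K) ∩ U` is co-free in `U`: it is normal and open in `U`
  (continuity), and `U/(f⁻¹(K) ∩ U)` EMBEDS in the free group `H/K`, hence is free by the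
  Nielsen–Schreier theorem (Mathlib `subgroupIsFreeOfIsFree`) — the same argument as abc-iut-L4-t13
  gen 3's `IsCofreeIn.inf_of_le` (the case `f = id`), no surjectivity needed;
* `cofreeCore_le_comap_cofreeCore` / `cofreeCore_map_le` — consequently `f(U^{co-fr}) ⊆ H^{co-fr}` for
  the co-free cores (`= the minimal co-free subgroups` whenever these exist,
  `cofreeCore_eq_of_isMinimalCofreeIn`), in particular `f(f⁻¹(H)^{co-fr}) ⊆ H^{co-fr}`
  (`cofreeCore_map_comap_le`): "filling a cusp, graph coverings pull back to graph-dominated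
  coverings" is pure group theory;
* the PULLBACK FORM of the comparison, `(f⁻¹H)^{co-fr} = f⁻¹H ∩ f⁻¹(H^{co-fr})`: its `≤` half is the
  above; GIVEN the `≥` half (the honest geometric residue of row iii.L04 at genuine tempered data:
  injectivity of `π₁(Γ_{X_{f⁻¹H}}) → π₁(Γ_{Y_H})`, "filling a cusp does not change the dual graph"),
  the image `f((f⁻¹H)^{co-fr})` is EXACTLY `f(f⁻¹H) ∩ H^{co-fr}` (`map_cofreeCore_eq_of_pullback`), so
  the EQUALITY `f((f⁻¹H)^{co-fr}) = H^{co-fr}` as typed in `CoFreeCompatAlong` additionally needs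
  `H^{co-fr} ⊆ f(Π₁)` — a surjectivity-type clause (cf. L4-lead RULING #3f: print's tempered maps are
  DENSE, [AbsTopI] Def 4.11 (i)(c)).

Pure topology/group theory; nothing here bears on [IUTchIII] Cor 3.12.
-/

noncomputable section

open _root_.Topology

universe u v

namespace Literature.AnabelianGeometry.AbsoluteAnabelian.AbsTopI

open Literature.AnabelianGeometry.EtaleTheta (IsCofree IsMinimalCofree)

variable {P₁ : Type u} {P₂ : Type v} [Group P₁] [TopologicalSpace P₁] [Group P₂] [TopologicalSpace P₂]

/-! ### Pulling back co-free subgroups -/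

/-- **Co-free subgroups pull back**: if `K` is co-free in `H` (subgroups of `Π₂`), `f : Π₁ → Π₂` is a
continuous homomorphism and `U ≤ Π₁` satisfies `f(U) ⊆ H`, then `f⁻¹(K) ∩ U` is co-free in `U` —
normal and open in `U`, with `U/(f⁻¹(K) ∩ U) ↪ H/K` free by Nielsen–Schreier ([AbsTopI] §0 p. 8; the
case `f = id` is `IsCofreeIn.inf_of_le`). [cite: MochizukiAbsTopI2012, §0 p.8] -/
theorem IsCofreeIn.comap_inf {H K : Subgroup P₂} (hK : IsCofreeIn H K) (f : P₁ →ₜ* P₂)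
    {U : Subgroup P₁} (hU : U.map f.toMonoidHom ≤ H) :
    IsCofreeIn U (K.comap f.toMonoidHom ⊓ U) := by
  obtain ⟨hKH, hN, hcf⟩ := hK
  have hUH : ∀ u : U, f (u : P₁) ∈ H := fun u => hU ⟨u, u.2, rfl⟩
  -- the restriction `U → H` of `f`
  let fU : U →* H :=
    { toFun := fun u => ⟨f (u : P₁), hUH u⟩
      map_one' := Subtype.ext (by simp)
      map_mul' := fun a b => Subtype.ext (by simp) }
  have hfU : Continuous fU := (f.continuous.comp continuous_subtype_val).subtype_mk _
  -- `U → H → H/K`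
  let φ : U →* H ⧸ K.subgroupOf H := (QuotientGroup.mk' (K.subgroupOf H)).comp fU
  have hker : φ.ker = (K.comap f.toMonoidHom ⊓ U).subgroupOf U := by
    ext x
    simp only [φ, fU, MonoidHom.mem_ker, MonoidHom.coe_comp, QuotientGroup.coe_mk', Function.comp_apply,
      QuotientGroup.eq_one_iff, Subgroup.mem_subgroupOf, Subgroup.mem_inf, Subgroup.mem_comap,
      MonoidHom.coe_mk, OneHom.coe_mk, SetLike.coe_mem, and_true]
    rfl
  have hNorm : ((K.comap f.toMonoidHom ⊓ U).subgroupOf U).Normal := by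
    rw [← hker]
    infer_instance
  refine ⟨inf_le_right, hNorm, ⟨?_, ?_⟩⟩
  · -- openness: the preimage of the open `K ∩ H ⊆ H` under the continuous `U → H`
    have heq : ((K.comap f.toMonoidHom ⊓ U).subgroupOf U : Set U) = fU ⁻¹' (K.subgroupOf H : Set H) := by
      ext x
      simp only [SetLike.mem_coe, Subgroup.mem_subgroupOf, Subgroup.mem_inf, Subgroup.mem_comap,
        Set.mem_preimage, SetLike.coe_mem, and_true]
      rfl
    rw [heq]
    exact hcf.isOpen.preimage hfU
  · -- freeness: `U/(f⁻¹K ∩ U) ≃ U/ker φ ≃ range φ ≤ H/K`, a subgroup of a free group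
    haveI : IsFreeGroup (H ⧸ K.subgroupOf H) := hcf.isFreeGroup_quotient
    haveI : IsFreeGroup φ.range := subgroupIsFreeOfIsFree φ.range
    haveI : IsFreeGroup (U ⧸ φ.ker) := IsFreeGroup.ofMulEquiv (QuotientGroup.quotientKerEquivRange φ).symm
    exact IsFreeGroup.ofMulEquiv (QuotientGroup.quotientMulEquivOfEq hker)

/-- Co-free subgroups pull back along preimages: `K` co-free in `H` ⟹ `f⁻¹(K)` co-free in `f⁻¹(H)`.
[cite: MochizukiAbsTopI2012, §0 p.8] -/
theorem IsCofreeIn.comap {H K : Subgroup P₂} (hK : IsCofreeIn H K) (f : P₁ →ₜ* P₂) :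
    IsCofreeIn (H.comap f.toMonoidHom) (K.comap f.toMonoidHom) := by
  have h := hK.comap_inf f (U := H.comap f.toMonoidHom) (Subgroup.map_comap_le _ _)
  rwa [inf_eq_left.mpr (Subgroup.comap_mono hK.le)] at h

/-! ### The co-free core along a homomorphism: the inclusion half -/

/-- **`f(U^{co-fr}) ⊆ H^{co-fr}` whenever `f(U) ⊆ H`** (co-free cores; = the minimal co-free subgroups
when these exist, [AbsTopI] §0 p. 8), in the form `U^{co-fr} ≤ f⁻¹(H^{co-fr})`: an element of every
co-free subgroup of `U` lies in `f⁻¹(K) ∩ U` for every co-free `K ⊆ H`. [cite: MochizukiAbsTopI2012, §0 p.8] -/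
theorem cofreeCore_le_comap_cofreeCore (f : P₁ →ₜ* P₂) {U : Subgroup P₁} {H : Subgroup P₂}
    (hU : U.map f.toMonoidHom ≤ H) : cofreeCore U ≤ (cofreeCore H).comap f.toMonoidHom := by
  intro x hx
  rw [Subgroup.mem_comap]
  have hxU : x ∈ U := cofreeCore_le U hx
  refine Subgroup.mem_inf.mpr ⟨hU ⟨x, hxU, rfl⟩, ?_⟩
  refine Subgroup.mem_iInf.mpr fun K => Subgroup.mem_iInf.mpr fun hK => ?_
  have hx' : x ∈ K.comap f.toMonoidHom ⊓ U := cofreeCore_le_of_isCofreeIn (hK.comap_inf f hU) hx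
  exact (Subgroup.mem_inf.mp hx').1

/-- **`f(U^{co-fr}) ⊆ H^{co-fr}` whenever `f(U) ⊆ H`**, image form. [cite: MochizukiAbsTopI2012, §0 p.8] -/
theorem cofreeCore_map_le (f : P₁ →ₜ* P₂) {U : Subgroup P₁} {H : Subgroup P₂}
    (hU : U.map f.toMonoidHom ≤ H) : (cofreeCore U).map f.toMonoidHom ≤ cofreeCore H :=
  Subgroup.map_le_iff_le_comap.mpr (cofreeCore_le_comap_cofreeCore f hU)

/-- `(f⁻¹H)^{co-fr} ⊆ f⁻¹(H^{co-fr})`: the INCLUSION half of the pullback form of the comparison of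
minimal co-free subgroups along `f` ([AbsTopI] Prop 4.10 (iii) p. 60, "follows immediately from (i)",
p. 61) holds for every continuous homomorphism. [cite: MochizukiAbsTopI2012, Prop 4.10 (iii) p.60] -/
theorem cofreeCore_comap_le (f : P₁ →ₜ* P₂) (H : Subgroup P₂) :
    cofreeCore (H.comap f.toMonoidHom) ≤ (cofreeCore H).comap f.toMonoidHom :=
  cofreeCore_le_comap_cofreeCore f (Subgroup.map_comap_le _ _)

/-- `f((f⁻¹H)^{co-fr}) ⊆ H^{co-fr}` — the shape of the hypothesis `hcompat` of
`coFreeCofinalImAlong_right_of` (`AbsTopIProp410CofinalProofs.lean`), now a theorem for every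
continuous homomorphism. [cite: MochizukiAbsTopI2012, Prop 4.10 (iii) p.60] -/
theorem cofreeCore_map_comap_le (f : P₁ →ₜ* P₂) (H : Subgroup P₂) :
    (cofreeCore (H.comap f.toMonoidHom)).map f.toMonoidHom ≤ cofreeCore H :=
  cofreeCore_map_le f (Subgroup.map_comap_le _ _)

/-- The pullback form is sandwiched: `(f⁻¹H)^{co-fr} ⊆ f⁻¹H ∩ f⁻¹(H^{co-fr})`.
[cite: MochizukiAbsTopI2012, Prop 4.10 (iii) p.60] -/
theorem cofreeCore_comap_le_inf (f : P₁ →ₜ* P₂) (H : Subgroup P₂) :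
    cofreeCore (H.comap f.toMonoidHom) ≤
      H.comap f.toMonoidHom ⊓ (cofreeCore H).comap f.toMonoidHom :=
  le_inf (cofreeCore_le _) (cofreeCore_comap_le f H)

/-! ### The pullback form and what the equality of images needs beyond it -/

/-- **Given the PULLBACK FORM** `f⁻¹H ∩ f⁻¹(H^{co-fr}) ⊆ (f⁻¹H)^{co-fr}` (the `≥` half; the `≤` half is
`cofreeCore_comap_le_inf`), the image of the co-free core is EXACTLY the trace of `H^{co-fr}` on the
image: `f((f⁻¹H)^{co-fr}) = f(f⁻¹H) ∩ H^{co-fr}`. [cite: MochizukiAbsTopI2012, Prop 4.10 (iii) p.60] -/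
theorem map_cofreeCore_comap_eq_of_pullback (f : P₁ →ₜ* P₂) (H : Subgroup P₂)
    (hpull : H.comap f.toMonoidHom ⊓ (cofreeCore H).comap f.toMonoidHom ≤
      cofreeCore (H.comap f.toMonoidHom)) :
    (cofreeCore (H.comap f.toMonoidHom)).map f.toMonoidHom =
      (H.comap f.toMonoidHom).map f.toMonoidHom ⊓ cofreeCore H := by
  refine le_antisymm (le_inf (Subgroup.map_mono (cofreeCore_le _)) (cofreeCore_map_comap_le f H)) ?_
  rintro y ⟨⟨u, hu, rfl⟩, hy⟩
  exact ⟨u, hpull (Subgroup.mem_inf.mpr ⟨hu, Subgroup.mem_comap.mpr hy⟩), rfl⟩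

/-- **Equality of images from the pullback form plus an image clause**: if moreover `H^{co-fr} ⊆ f(f⁻¹H)`
(i.e. `H^{co-fr}` lies in the image of `f` — a SURJECTIVITY-type clause), then
`f((f⁻¹H)^{co-fr}) = H^{co-fr}` (the shape of row iii.L04 `CoFreeCompatAlong` as typed).
[cite: MochizukiAbsTopI2012, Prop 4.10 (iii) p.60] -/
theorem map_cofreeCore_comap_eq_of_pullback_of_le_map (f : P₁ →ₜ* P₂) (H : Subgroup P₂)
    (hpull : H.comap f.toMonoidHom ⊓ (cofreeCore H).comap f.toMonoidHom ≤
      cofreeCore (H.comap f.toMonoidHom))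
    (himg : cofreeCore H ≤ (H.comap f.toMonoidHom).map f.toMonoidHom) :
    (cofreeCore (H.comap f.toMonoidHom)).map f.toMonoidHom = cofreeCore H := by
  rw [map_cofreeCore_comap_eq_of_pullback f H hpull]
  exact inf_eq_right.mpr himg

/-- Conversely, the equality of images `f((f⁻¹H)^{co-fr}) = H^{co-fr}` forces the image clause
`H^{co-fr} ⊆ f(f⁻¹H)` (so that clause is NECESSARY for `CoFreeCompatAlong` as typed).
[cite: MochizukiAbsTopI2012, Prop 4.10 (iii) p.60] -/
theorem cofreeCore_le_map_comap_of_map_eq (f : P₁ →ₜ* P₂) (H : Subgroup P₂)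
    (heq : (cofreeCore (H.comap f.toMonoidHom)).map f.toMonoidHom = cofreeCore H) :
    cofreeCore H ≤ (H.comap f.toMonoidHom).map f.toMonoidHom := by
  rw [← heq]
  exact Subgroup.map_mono (cofreeCore_le _)

/-- Conversely, the equality of images forces the pullback form UP TO THE KERNEL: every element of
`f⁻¹H ∩ f⁻¹(H^{co-fr})` is congruent modulo `Ker f` to an element of `(f⁻¹H)^{co-fr}`; so the pullback
form is equivalent, given the equality of images, to `Ker f ∩ f⁻¹H ⊆ (f⁻¹H)^{co-fr}` ("the inertia of
the filled cusp dies in the dual graph"). [cite: MochizukiAbsTopI2012, Prop 4.10 (iii) p.60] -/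
theorem pullback_of_map_eq_of_ker_le (f : P₁ →ₜ* P₂) (H : Subgroup P₂)
    (heq : (cofreeCore (H.comap f.toMonoidHom)).map f.toMonoidHom = cofreeCore H)
    (hker : f.toMonoidHom.ker ⊓ H.comap f.toMonoidHom ≤ cofreeCore (H.comap f.toMonoidHom)) :
    H.comap f.toMonoidHom ⊓ (cofreeCore H).comap f.toMonoidHom ≤
      cofreeCore (H.comap f.toMonoidHom) := by
  intro u hu'
  obtain ⟨hu, hfu⟩ := Subgroup.mem_inf.mp hu'
  have hfu' : f.toMonoidHom u ∈ (cofreeCore (H.comap f.toMonoidHom)).map f.toMonoidHom := by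
    rw [heq]; exact Subgroup.mem_comap.mp hfu
  obtain ⟨v, hv, hvu⟩ := hfu'
  -- `u = v · (v⁻¹ u)` with `v ∈ (f⁻¹H)^{co-fr}` and `v⁻¹ u ∈ Ker f ∩ f⁻¹H`
  have hk : v⁻¹ * u ∈ f.toMonoidHom.ker ⊓ H.comap f.toMonoidHom := by
    refine Subgroup.mem_inf.mpr ⟨?_, ?_⟩
    · rw [MonoidHom.mem_ker, map_mul, map_inv, hvu, inv_mul_cancel]
    · exact Subgroup.mul_mem _ (Subgroup.inv_mem _ (cofreeCore_le _ hv)) hu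
  rw [← mul_inv_cancel_left v u]
  exact Subgroup.mul_mem _ hv (hker hk)

/-- The kernel clause follows from the pullback form: `Ker f ∩ f⁻¹H ⊆ (f⁻¹H)^{co-fr}` (as
`f(Ker f) = 1 ⊆ H^{co-fr}`). [cite: MochizukiAbsTopI2012, Prop 4.10 (iii) p.60] -/
theorem ker_inf_comap_le_cofreeCore_of_pullback (f : P₁ →ₜ* P₂) (H : Subgroup P₂)
    (hpull : H.comap f.toMonoidHom ⊓ (cofreeCore H).comap f.toMonoidHom ≤
      cofreeCore (H.comap f.toMonoidHom)) :
    f.toMonoidHom.ker ⊓ H.comap f.toMonoidHom ≤ cofreeCore (H.comap f.toMonoidHom) := by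
  intro u hu'
  obtain ⟨hu, huH⟩ := Subgroup.mem_inf.mp hu'
  refine hpull (Subgroup.mem_inf.mpr ⟨huH, ?_⟩)
  rw [Subgroup.mem_comap, (MonoidHom.mem_ker).mp hu]
  exact Subgroup.one_mem _

end Literature.AnabelianGeometry.AbsoluteAnabelian.AbsTopI

end
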